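/-
Copyright (c) 2026 the pub-hodgecm-mathlib formalisation cell (harness21).  Prover seat hodgecm-mathlib-F0P3a-p01 (g37), FLOOR 0, SUPPORTS-ONLY on h413; β-BOARD v1 R10
(assembler ∕ chair): the TOWER-2 rest rows `hC₂` (window) and `hR6₂` (κ line) as the (0 1)-swap images of the tower-1 rows, by ★ p861439's engine.  2026-09-04.
-/
import Summits.HodgeConjecture.HodgeConjecture.Theorems.F0P3cDyRamLabelledOddSwapEngine            -- ★ p861439 (LH4-p18 (g0)): `finsum_stratum_shell_labelledOdd_div_relIndex_swap01_of`
import Summits.HodgeConjecture.HodgeConjecture.Theorems.F0P3cDyRamStageOneBDerivedDefs            -- ★ p859675: `n0DerivedOfRecord`; brings `mcOfRecord`, `mstarOfRecord`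
import Summits.HodgeConjecture.HodgeConjecture.Theorems.F0P3cDyRamDiagonalKappaSplitCountEval       -- ★: `normSign_mul_self`
import Literature.NumberTheory.LocalFields.WildQuadraticDatumNormSignConductor                      -- ★: `normSign_mul_of_fixed`
import HarnessLib

/-!
# Crux `H413`, LH4 «(D-RAM) FOUR-FRAME» road, STAGE 1b (β) — THE TOWER-2 REST ROWS `hC₂` AND `hR6₂` AS (0 1)-SWAP IMAGES OF THE TOWER-1 ROWS

Cell `hodgecm-mathlib` (D-0151), FLOOR 0, crux item H413 = `stmt-HodgeConjecture-24833`, route `HCCMUnconditional`; squad F0∕P3c∕LH4.  THEOREMS ONLY (no `def`, no instance, no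
notation, no `sorry`, default heartbeats); ★-only imports; lane `--supports stmt-HodgeConjecture-24833 --as helper` (count-neutral; pays NO row).

WHAT THIS FILE DOES (chair's LEDGER #14–#16).  The rest assembly ★ `restSum_eq_restTarget_of_rows` wants, for tower 2, the window row `hC₂` (`n₂ = n₁ + s`, `n₁ ≤ 2ρ+ℓ₀`,
`2ρ + mc ≤ 2n₁` ⇒ `0`) and the κ line `hR6₂` (`2ρ+ℓ₀ = n₁`, `n₂ ≠ n₁ + s` ⇒ LH4-p10's closed form `(0, ω_B + ω_C, 0)_i ∕ 4 · q^(2ρ−1+s∕2) · F(n₂)`).  Both are the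
(0 1)-swap images of the tower-1 rows (LH7-p05 (g0)'s window `hC₁`; LH4-p07 (g10)'s κ-line junction `hR6₁` over LH4-p11 (g9)'s lattice heads): ★ p861439
`finsum_stratum_shell_labelledOdd_div_relIndex_swap01_of` carries ANY tower-1 statement uniform in the element datum to the swapped stratum at the swapped datum `(β, α; n₂, n₁, n₃)`
(slot `i ↦ (0 1) i`, label and clean-shell tokens (0 1)-symmetric).  For the κ line the tokens travel as the witness: at the swapped datum the `e_A`-slot token (of
`α' − 1 = β − 1` at depth `n₂' = n₁`) is `e_B`, and the `e_C`-slot token (of `β' − α' = α − β` at depth `n₃`) is `−e_C`; so the tower-1 value `(ω(e_B) + ω(−1)·ω(−e_C), 0, 0)` read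
in slot `(0 1) i` becomes `(0, ω_B + ω_C, 0)_i` by `ω(−e_C) = ω(−1)·ω(e_C)` (★ `normSign_mul_of_fixed`) and `ω(−1)² = 1` (★ `normSign_mul_self`).  The tower-1 rows enter as
∀-hypotheses over the element datum at the derived threshold (binder shapes = the chair's LEDGER #16 texts, ∀-closed over `(α', β'; n₁', n₂', n₃')`, `T'` and the tokens); this
file is independent of how they are proved.
HONEST LABEL.  Count-neutral transport; `hC₁`, `hR6₁` are hypotheses here; `hRest`, (β) OPEN; `HC_CM` is proved only modulo the 7 printed citations (2 remaining named inputs: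
hLiu418 = `stmt-HodgeConjecture-24832`, h413 = `stmt-HodgeConjecture-24833`) until rung 0 closes.

## References
* [Kottwitz1986BaseChangeUnits] R. E. Kottwitz, *Base change for unit elements of Hecke algebras*, Compositio Math. 60 (1986), §1 pp. 240–241 (lattice counts modulo the
  diagonal torus; symmetry in the coordinates of the split torus).
* [Rogawski1990] J. D. Rogawski, *Automorphic Representations of Unitary Groups in Three Variables*, Ann. of Math. Stud. 123 (1990), §4.9 Prop. 4.9.1 (a)(b) p. 55, §4.10 p. 58.
* [Serre1979] J.-P. Serre, *Local Fields*, GTM 67, Springer (1979), Ch. V §3, Ch. XIV §3 (the norm residue character of a ramified quadratic extension).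
-/

set_option autoImplicit false

noncomputable section

namespace Summit.HodgeConjecture.HodgeConjecture.Cruxes.H413.F0P3cDyRamOddLabelledRestRowsG2OfSwap

open Matrix
open Literature.NumberTheory.Automorphic Literature.NumberTheory.Automorphic.HermitianLattice
open Literature.NumberTheory.Automorphic.UnitaryLatticeTree Literature.NumberTheory.Automorphic.UnitaryThreeFourFrame
open Literature.NumberTheory.LocalFields Literature.NumberTheory.LocalFields.WildQuadraticDatum
open Summit.HodgeConjecture.HodgeConjecture.Cruxes.H413.F0P3cDyRamFourFramePieces (mstarOfRecord)
open Summit.HodgeConjecture.HodgeConjecture.Cruxes.H413.F0P3cDyRamFourFrameCensusDefs (LatticeInLevel)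
open Summit.HodgeConjecture.HodgeConjecture.Cruxes.H413.F0P3cDyRamStageOneBDefs (mcOfRecord)
open Summit.HodgeConjecture.HodgeConjecture.Cruxes.H413.F0P3cDyRamStageOneBDerivedDefs (n0DerivedOfRecord)
open Summit.HodgeConjecture.HodgeConjecture.Cruxes.H413.F0P3cDyRamDiagonalTorusDefs
open Summit.HodgeConjecture.HodgeConjecture.Cruxes.H413.F0P3cDyRamDiagonalStrataDefs
open Summit.HodgeConjecture.HodgeConjecture.Cruxes.H413.F0P3cDyRamLabelledOddCountDefs
open Summit.HodgeConjecture.HodgeConjecture.Cruxes.H413.F0P3cDyRamLabelledOddSwapEngine (finsum_stratum_shell_labelledOdd_div_relIndex_swap01_of)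
open Summit.HodgeConjecture.HodgeConjecture.Cruxes.H413.F0P3cDyRamDiagonalKappaSplitCountEval (normSign_mul_self)
open scoped Valued WithZero Matrix MatrixGroups

variable {K : Type} [Field K] [Valued K ℤᵐ⁰] {σ : K →+* K} {ϖ : K} {d t : ℕ} {α β : K} {n₁ n₂ n₃ : ℕ}

/-! ## §1  The window: `hC₂` from `hC₁` -/

/-- **THE TOWER-2 WINDOW ROW FROM THE TOWER-1 WINDOW ROW.**  If at EVERY element datum at the derived threshold the tower-1 window classes (`n₁' = n₂' + s`, `n₂' ≤ 2ρ + ℓ₀`,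
`2ρ + mcOfRecord d ≤ 2n₂'`) of `G₁ = (2ρ, 2ρ+s, 2ρ+s)` carry clean-shell labelled-odd value `0` (LH7-p05 (g0)'s R7-C), then at the datum `(α, β; n₁, n₂, n₃)` the tower-2
window classes (`n₂ = n₁ + s`, `n₁ ≤ 2ρ + ℓ₀`, `2ρ + mcOfRecord d ≤ 2n₁`) of `G₂ = (2ρ+s, 2ρ, 2ρ+s)` carry `0` — the `hC₂` binder of ★ `restSum_eq_restTarget_of_rows` verbatim.
[cite: Kottwitz1986BaseChangeUnits, §1 pp. 240–241] [cite: Rogawski1990, §4.9 Prop. 4.9.1 (a)(b) p. 55] -/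
theorem window_G2_of_G1
    (hC₁ : ∀ {α' β' : K} {n₁' n₂' n₃' : ℕ} (T' : GL (Fin 3) K), IsElementDatum σ ϖ (n0DerivedOfRecord d) α' β' n₁' n₂' n₃' →
      (T' : Matrix (Fin 3) (Fin 3) K) = Matrix.diagonal ![α', β', 1] →
      ∀ (ρ s : ℕ), 1 ≤ ρ → 1 ≤ s → n₁' = n₂' + s → n₂' ≤ 2 * ρ + d % 2 → 2 * ρ + mcOfRecord d ≤ 2 * n₂' → ∀ i : Fin 3,
        ∑ᶠ M ∈ {M : Submodule 𝒪[K] (Fin 3 → K) | M ∈ stratum σ ϖ T' ![2 * ρ, 2 * ρ + s, 2 * ρ + s] ∧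
            (LatticeInLevel ϖ (d % 2) (Matrix.diagonal ![α' - 1, β' - 1, 0]) M ∧ ¬ LatticeInLevel ϖ (d % 2 + 1) (Matrix.diagonal ![α' - 1, β' - 1, 0]) M ∧
              LatticeInLevel ϖ (mcOfRecord d) (Matrix.diagonal ![(α' - 1) * (α' - 1), (β' - 1) * (β' - 1), 0]) M)},
          (labelledOddCount σ ϖ 0 i (valueClassLabel σ ϖ (α' - 1) (β' - 1) (mstarOfRecord d) d) M : ℚ) /
            ((((unitStabilizer M).map (unitNormMap σ 3)).relIndex (fixedUnitTorus σ 3) : ℕ) : ℚ) = 0)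
    (hE : IsElementDatum σ ϖ (n0DerivedOfRecord d) α β n₁ n₂ n₃)
    (T : GL (Fin 3) K) (hT : (T : Matrix (Fin 3) (Fin 3) K) = Matrix.diagonal ![α, β, 1])
    (ρ s : ℕ) (hρ : 1 ≤ ρ) (hs : 1 ≤ s) (hfoot : n₂ = n₁ + s) (hwin : n₁ ≤ 2 * ρ + d % 2) (hmc : 2 * ρ + mcOfRecord d ≤ 2 * n₁) (i : Fin 3) :
    ∑ᶠ M ∈ {M : Submodule 𝒪[K] (Fin 3 → K) | M ∈ stratum σ ϖ T ![2 * ρ + s, 2 * ρ, 2 * ρ + s] ∧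
        (LatticeInLevel ϖ (d % 2) (Matrix.diagonal ![α - 1, β - 1, 0]) M ∧ ¬ LatticeInLevel ϖ (d % 2 + 1) (Matrix.diagonal ![α - 1, β - 1, 0]) M ∧
          LatticeInLevel ϖ (mcOfRecord d) (Matrix.diagonal ![(α - 1) * (α - 1), (β - 1) * (β - 1), 0]) M)},
      (labelledOddCount σ ϖ 0 i (valueClassLabel σ ϖ (α - 1) (β - 1) (mstarOfRecord d) d) M : ℚ) /
        ((((unitStabilizer M).map (unitNormMap σ 3)).relIndex (fixedUnitTorus σ 3) : ℕ) : ℚ) = 0 := by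
  have key := finsum_stratum_shell_labelledOdd_div_relIndex_swap01_of hE hT 0 (2 * ρ) (2 * ρ + s) (2 * ρ + s) (d % 2) (d % 2 + 1)
    (mcOfRecord d) (mstarOfRecord d) d (W := Unit)
    (fun _ _ n₁' n₂' _ _ => n₁' = n₂' + s ∧ n₂' ≤ 2 * ρ + d % 2 ∧ 2 * ρ + mcOfRecord d ≤ 2 * n₂')
    (fun _ _ _ _ _ _ _ => (0 : ℚ))
    (fun T' _ hE' hT' hHyp j => hC₁ T' hE' hT' ρ s hρ hs hHyp.1 hHyp.2.1 hHyp.2.2 j)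
    () ⟨hfoot, hwin, hmc⟩ i
  rw [key]

/-! ## §2  The κ line: `hR6₂` from `hR6₁` -/

/-- **THE TOWER-2 κ LINE FROM THE TOWER-1 κ LINE.**  If at EVERY element datum at the derived threshold, with tokens `eA'` (of `α' − 1` at depth `n₂'`) and `eC'` (of `β' − α'`
at depth `n₃'`), the κ-locus classes of tower 1 (`2ρ + ℓ₀ = n₂'`, off the foot `n₁' ≠ n₂' + s`) carry LH4-p10's closed form `(ω(eA') + ω(−1)ω(eC'), 0, 0)_i ∕ 4 · q^(2ρ−1+s∕2) ·
F(n₁')` (LH4-p07 (g10)'s κ-line junction `hR6₁`), then at `(α, β; n₁, n₂, n₃)` with tokens `eB` (of `β − 1` at `n₁`) and `eC` (of `β − α` at `n₃`) the κ-locus classes of tower 2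
(`2ρ + ℓ₀ = n₁`, `n₂ ≠ n₁ + s`) carry `(0, ω_B + ω_C, 0)_i ∕ 4 · q^(2ρ−1+s∕2) · F(n₂)` — the `hR6₂` binder of ★ `restSum_eq_restTarget_of_rows` verbatim (witness `(eB, −eC)`;
`ω(−eC) = ω(−1)ω(eC)`, `ω(−1)² = 1`). [cite: Kottwitz1986BaseChangeUnits, §1 pp. 240–241] [cite: Rogawski1990, §4.9 Prop. 4.9.1 (a)(b) p. 55, §4.10 p. 58] [cite: Serre1979, Ch. V §3] -/
theorem kappaLine_G2_of_G1 [CompleteSpace K] [Fintype 𝓀[K]] (hD : IsRamifiedQuadraticDatum σ ϖ d t)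
    (hR6₁ : ∀ {α' β' : K} {n₁' n₂' n₃' : ℕ} (T' : GL (Fin 3) K) (eA' eC' : K), IsElementDatum σ ϖ (n0DerivedOfRecord d) α' β' n₁' n₂' n₃' →
      (T' : Matrix (Fin 3) (Fin 3) K) = Matrix.diagonal ![α', β', 1] →
      σ eA' = eA' → Valued.v eA' = 1 → Valued.v ((ϖ ^ mstarOfRecord d)⁻¹ * ((α' - 1) * ((ϖ * σ ϖ) ^ ((n₂' - d % 2) / 2))⁻¹ - eA' * ((ϖ - σ ϖ) * ((ϖ * σ ϖ) ^ ((d - d % 2) / 2))⁻¹))) ≤ 1 →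
      σ eC' = eC' → Valued.v eC' = 1 → Valued.v ((ϖ ^ mstarOfRecord d)⁻¹ * ((β' - α') * ((ϖ * σ ϖ) ^ ((n₃' - d % 2) / 2))⁻¹ - eC' * ((ϖ - σ ϖ) * ((ϖ * σ ϖ) ^ ((d - d % 2) / 2))⁻¹))) ≤ 1 →
      ∀ (ρ s : ℕ), 1 ≤ ρ → 1 ≤ s → 2 ∣ s → 2 * ρ + d % 2 = n₂' → n₁' ≠ n₂' + s → ∀ i : Fin 3,
        ∑ᶠ M ∈ {M : Submodule 𝒪[K] (Fin 3 → K) | M ∈ stratum σ ϖ T' ![2 * ρ, 2 * ρ + s, 2 * ρ + s] ∧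
            (LatticeInLevel ϖ (d % 2) (Matrix.diagonal ![α' - 1, β' - 1, 0]) M ∧ ¬ LatticeInLevel ϖ (d % 2 + 1) (Matrix.diagonal ![α' - 1, β' - 1, 0]) M ∧
              LatticeInLevel ϖ (mcOfRecord d) (Matrix.diagonal ![(α' - 1) * (α' - 1), (β' - 1) * (β' - 1), 0]) M)},
          (labelledOddCount σ ϖ 0 i (valueClassLabel σ ϖ (α' - 1) (β' - 1) (mstarOfRecord d) d) M : ℚ) /
            ((((unitStabilizer M).map (unitNormMap σ 3)).relIndex (fixedUnitTorus σ 3) : ℕ) : ℚ) =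
        (![(normSign σ eA' : ℚ) + (normSign σ (-1 : K) : ℚ) * (normSign σ eC' : ℚ), 0, 0] : Fin 3 → ℚ) i / 4 * (Fintype.card 𝓀[K] : ℚ) ^ (2 * ρ - 1 + s / 2) *
          ((if 2 * d + d % 2 + 2 * ρ + s ≤ n₁' then (Fintype.card 𝓀[K] : ℚ) - 1 else 0) - (if n₁' + 2 = 2 * d + d % 2 + 2 * ρ + s then 1 else 0)))
    (hE : IsElementDatum σ ϖ (n0DerivedOfRecord d) α β n₁ n₂ n₃)
    (T : GL (Fin 3) K) (hT : (T : Matrix (Fin 3) (Fin 3) K) = Matrix.diagonal ![α, β, 1])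
    {eB eC : K} (hσeB : σ eB = eB) (heB1 : Valued.v eB = 1) (heB : Valued.v ((ϖ ^ mstarOfRecord d)⁻¹ * ((β - 1) * ((ϖ * σ ϖ) ^ ((n₁ - d % 2) / 2))⁻¹ - eB * ((ϖ - σ ϖ) * ((ϖ * σ ϖ) ^ ((d - d % 2) / 2))⁻¹))) ≤ 1)
    (hσeC : σ eC = eC) (heC1 : Valued.v eC = 1) (heC : Valued.v ((ϖ ^ mstarOfRecord d)⁻¹ * ((β - α) * ((ϖ * σ ϖ) ^ ((n₃ - d % 2) / 2))⁻¹ - eC * ((ϖ - σ ϖ) * ((ϖ * σ ϖ) ^ ((d - d % 2) / 2))⁻¹))) ≤ 1)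
    (ρ s : ℕ) (hρ : 1 ≤ ρ) (hs : 1 ≤ s) (h2s : 2 ∣ s) (hloc : 2 * ρ + d % 2 = n₁) (hfoot : n₂ ≠ n₁ + s) (i : Fin 3) :
    ∑ᶠ M ∈ {M : Submodule 𝒪[K] (Fin 3 → K) | M ∈ stratum σ ϖ T ![2 * ρ + s, 2 * ρ, 2 * ρ + s] ∧
        (LatticeInLevel ϖ (d % 2) (Matrix.diagonal ![α - 1, β - 1, 0]) M ∧ ¬ LatticeInLevel ϖ (d % 2 + 1) (Matrix.diagonal ![α - 1, β - 1, 0]) M ∧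
          LatticeInLevel ϖ (mcOfRecord d) (Matrix.diagonal ![(α - 1) * (α - 1), (β - 1) * (β - 1), 0]) M)},
      (labelledOddCount σ ϖ 0 i (valueClassLabel σ ϖ (α - 1) (β - 1) (mstarOfRecord d) d) M : ℚ) /
        ((((unitStabilizer M).map (unitNormMap σ 3)).relIndex (fixedUnitTorus σ 3) : ℕ) : ℚ) =
      (![(0 : ℚ), (normSign σ eB : ℚ) + (normSign σ eC : ℚ), 0] : Fin 3 → ℚ) i / 4 * (Fintype.card 𝓀[K] : ℚ) ^ (2 * ρ - 1 + s / 2) *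
        ((if 2 * d + d % 2 + 2 * ρ + s ≤ n₂ then (Fintype.card 𝓀[K] : ℚ) - 1 else 0) - (if n₂ + 2 = 2 * d + d % 2 + 2 * ρ + s then 1 else 0)) := by
  -- the token of `α − β = −(β − α)` at depth `n₃` is `−eC`
  have hσnC : σ (-eC) = -eC := by rw [map_neg, hσeC]
  have hnC1 : Valued.v (-eC) = 1 := by rw [Valuation.map_neg, heC1]
  have hnC : Valued.v ((ϖ ^ mstarOfRecord d)⁻¹ * ((α - β) * ((ϖ * σ ϖ) ^ ((n₃ - d % 2) / 2))⁻¹ - (-eC) * ((ϖ - σ ϖ) * ((ϖ * σ ϖ) ^ ((d - d % 2) / 2))⁻¹))) ≤ 1 := by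
    have h : (ϖ ^ mstarOfRecord d)⁻¹ * ((α - β) * ((ϖ * σ ϖ) ^ ((n₃ - d % 2) / 2))⁻¹ - (-eC) * ((ϖ - σ ϖ) * ((ϖ * σ ϖ) ^ ((d - d % 2) / 2))⁻¹)) =
        -((ϖ ^ mstarOfRecord d)⁻¹ * ((β - α) * ((ϖ * σ ϖ) ^ ((n₃ - d % 2) / 2))⁻¹ - eC * ((ϖ - σ ϖ) * ((ϖ * σ ϖ) ^ ((d - d % 2) / 2))⁻¹))) := by ring
    rw [h, Valuation.map_neg]; exact heC
  -- the engine at (a, b, c) = (2ρ, 2ρ+s, 2ρ+s), witness type `K × K` (the two tokens), `Hyp` = the κ-line side conditions, `F` = LH4-p10's tower-1 closed form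
  have key := finsum_stratum_shell_labelledOdd_div_relIndex_swap01_of hE hT 0 (2 * ρ) (2 * ρ + s) (2 * ρ + s) (d % 2) (d % 2 + 1)
    (mcOfRecord d) (mstarOfRecord d) d (W := K × K)
    (fun α' β' n₁' n₂' n₃' w => σ w.1 = w.1 ∧ Valued.v w.1 = 1 ∧ Valued.v ((ϖ ^ mstarOfRecord d)⁻¹ * ((α' - 1) * ((ϖ * σ ϖ) ^ ((n₂' - d % 2) / 2))⁻¹ - w.1 * ((ϖ - σ ϖ) * ((ϖ * σ ϖ) ^ ((d - d % 2) / 2))⁻¹))) ≤ 1 ∧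
      σ w.2 = w.2 ∧ Valued.v w.2 = 1 ∧ Valued.v ((ϖ ^ mstarOfRecord d)⁻¹ * ((β' - α') * ((ϖ * σ ϖ) ^ ((n₃' - d % 2) / 2))⁻¹ - w.2 * ((ϖ - σ ϖ) * ((ϖ * σ ϖ) ^ ((d - d % 2) / 2))⁻¹))) ≤ 1 ∧
      2 * ρ + d % 2 = n₂' ∧ n₁' ≠ n₂' + s)
    (fun α' β' n₁' n₂' n₃' w i => (![(normSign σ w.1 : ℚ) + (normSign σ (-1 : K) : ℚ) * (normSign σ w.2 : ℚ), 0, 0] : Fin 3 → ℚ) i / 4 *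
      (Fintype.card 𝓀[K] : ℚ) ^ (2 * ρ - 1 + s / 2) * ((if 2 * d + d % 2 + 2 * ρ + s ≤ n₁' then (Fintype.card 𝓀[K] : ℚ) - 1 else 0) - (if n₁' + 2 = 2 * d + d % 2 + 2 * ρ + s then 1 else 0)))
    (fun T' w hE' hT' hHyp j => hR6₁ T' w.1 w.2 hE' hT' hHyp.1 hHyp.2.1 hHyp.2.2.1 hHyp.2.2.2.1 hHyp.2.2.2.2.1 hHyp.2.2.2.2.2.1
      ρ s hρ hs h2s hHyp.2.2.2.2.2.2.1 hHyp.2.2.2.2.2.2.2 j)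
    (eB, -eC) ⟨hσeB, heB1, heB, hσnC, hnC1, hnC, hloc, hfoot⟩ i
  rw [key]
  -- `ω(−eC) = ω(−1)·ω(eC)` and `ω(−1)·ω(−1) = 1`
  have hσ1 : σ (-1 : K) = -1 := by rw [map_neg, map_one]
  have heC0 : eC ≠ 0 := fun h => by rw [h, map_zero] at heC1; exact zero_ne_one heC1
  have hneg : normSign σ (-eC) = normSign σ (-1 : K) * normSign σ eC := by
    rw [← neg_one_mul eC, normSign_mul_of_fixed hD hσ1 hσeC (neg_ne_zero.2 one_ne_zero) heC0]
  have hmm : (normSign σ (-1 : K) : ℚ) * (normSign σ (-1 : K) : ℚ) = 1 := by exact_mod_cast normSign_mul_self σ (-1 : K)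
  have hcoef : (normSign σ eB : ℚ) + (normSign σ (-1 : K) : ℚ) * (normSign σ (-eC) : ℚ) = (normSign σ eB : ℚ) + (normSign σ eC : ℚ) := by
    rw [hneg, Int.cast_mul, ← mul_assoc, hmm, one_mul]
  simp only [hcoef]
  -- the slot swap: `(x, 0, 0)` read at `(0 1) i` is `(0, x, 0)` read at `i`
  fin_cases i <;> rfl

end Summit.HodgeConjecture.HodgeConjecture.Cruxes.H413.F0P3cDyRamOddLabelledRestRowsG2OfSwap

end
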